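import Mathlib
import Summits.Parity.GeneralizedHardyLittlewood.Theorems.LiouvilleShiftedTablesPairsFromMAvgMainTerm
import Literature.NumberTheory.Sieve.BombieriAsymptoticSieveShiftedPrimes

/-!
# `PairsFromMAvg`, part 9: bounds for the pieces of the large part

Route `LiouvilleShiftedTables` (Parity / GeneralizedHardyLittlewood), support item stmt-Parity-14275
(`PairsFromMAvg`). With `D₁ = ⌊N/(M₀+1)⌋`, `T_d = ∑_{M₀ < m ≤ N/d} log m Λ(dm+h)`,
`X_d = ∑_{M₀ < m ≤ N/d} log m`:

* `abs_abelPart_le` — `|∑_{d ≤ D₁, (d,h)=1} μ(d)(T_d − (d/φ(d)) X_d)| ≤ 8 log N ∑_{d ≤ D₁} E*(x; d)`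
  for `x ≥ N + h` (part 6, summed);
* `abs_nonCoprimePart_le` — `|∑_{d ≤ D₁, (d,h)>1} μ(d) T_d| ≤ D₁ log N log(N + h)`;
* `sum_Icc_div_totient_le` — `∑_{d ≤ D} d/φ(d) ≤ D (1 + log D)²` (crude, from the tree's
  `natCast_div_totient_le`).

[folklore]
-/

noncomputable section

open Finset Real ArithmeticFunction Filter
open scoped ArithmeticFunction.Moebius

namespace Summit.Parity.GeneralizedHardyLittlewood.Theorems.PairsFromMAvg

open Literature.NumberTheory.Sieve (primeAPError primeAPError_nonneg natCast_div_totient_le)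

/-- **The Abel-summation errors, summed over the coprime moduli.** For `h ≥ 1` and `x ≥ N + h`:
`|∑_{d ≤ D₁, (d,h)=1} μ(d)(T_d − (d/φ(d)) X_d)| ≤ 8 log N · ∑_{d ≤ D₁} E*(x; d)`. [folklore] -/
theorem abs_abelPart_le {h : ℕ} (hh : 1 ≤ h) (N M₀ : ℕ) {x : ℝ} (hx : ((N + h : ℕ) : ℝ) ≤ x) :
    |∑ d ∈ (Icc 1 (N / (M₀ + 1))).filter (fun d => d.Coprime h),
        (μ d : ℝ) * (∑ m ∈ Ioc M₀ (N / d), Real.log m * Λ (d * m + h) -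
          (d : ℝ) / Nat.totient d * ∑ m ∈ Ioc M₀ (N / d), Real.log (m : ℝ))| ≤
      8 * Real.log N * ∑ d ∈ Icc 1 (N / (M₀ + 1)), primeAPError x d := by
  have hlogN : 0 ≤ Real.log N := Real.log_natCast_nonneg N
  have key : ∀ d ∈ (Icc 1 (N / (M₀ + 1))).filter (fun d => d.Coprime h),
      |(μ d : ℝ) * (∑ m ∈ Ioc M₀ (N / d), Real.log m * Λ (d * m + h) -
          (d : ℝ) / Nat.totient d * ∑ m ∈ Ioc M₀ (N / d), Real.log (m : ℝ))| ≤
        8 * Real.log N * primeAPError x d := by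
    intro d hd
    obtain ⟨hd', hcop⟩ := Finset.mem_filter.mp hd
    have hd1 : 1 ≤ d := (Finset.mem_Icc.mp hd').1
    have hE := primeAPError_nonneg x d
    have hxK : ((d * (N / d) + h : ℕ) : ℝ) ≤ x :=
      le_trans (by exact_mod_cast Nat.add_le_add_right (Nat.mul_div_le N d) h) hx
    have hb := abs_inner_sub_main_le (by omega) hh hcop M₀ (N / d) hxK
    have hlogq : Real.log ((N / d : ℕ) : ℝ) ≤ Real.log N := by
      rcases Nat.eq_zero_or_pos (N / d) with h0 | h0
      · rw [h0]; simp [hlogN]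
      · exact Real.log_le_log (by exact_mod_cast h0) (by exact_mod_cast Nat.div_le_self N d)
    rw [abs_mul]
    have hμ : |(μ d : ℝ)| ≤ 1 := by exact_mod_cast abs_moebius_le_one
    calc _ ≤ 1 * (8 * primeAPError x d * Real.log ((N / d : ℕ) : ℝ)) :=
          mul_le_mul hμ hb (abs_nonneg _) zero_le_one
      _ ≤ 1 * (8 * primeAPError x d * Real.log N) := by gcongr
      _ = 8 * Real.log N * primeAPError x d := by ring
  calc _ ≤ ∑ d ∈ (Icc 1 (N / (M₀ + 1))).filter (fun d => d.Coprime h),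
        |(μ d : ℝ) * (∑ m ∈ Ioc M₀ (N / d), Real.log m * Λ (d * m + h) -
          (d : ℝ) / Nat.totient d * ∑ m ∈ Ioc M₀ (N / d), Real.log (m : ℝ))| :=
        abs_sum_le_sum_abs _ _
    _ ≤ ∑ d ∈ (Icc 1 (N / (M₀ + 1))).filter (fun d => d.Coprime h),
          8 * Real.log N * primeAPError x d := Finset.sum_le_sum key
    _ ≤ ∑ d ∈ Icc 1 (N / (M₀ + 1)), 8 * Real.log N * primeAPError x d :=
        Finset.sum_le_sum_of_subset_of_nonneg (Finset.filter_subset _ _) fun d _ _ =>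
          mul_nonneg (by positivity) (primeAPError_nonneg x d)
    _ = 8 * Real.log N * ∑ d ∈ Icc 1 (N / (M₀ + 1)), primeAPError x d := by
        rw [Finset.mul_sum]

/-- **The moduli not coprime to `h`:** `|∑_{d ≤ D₁, (d,h)>1} μ(d) T_d| ≤ D₁ · log N · log(N+h)`
(`h ≠ 0`). [folklore] -/
theorem abs_nonCoprimePart_le {h : ℕ} (hh : h ≠ 0) (N M₀ : ℕ) :
    |∑ d ∈ (Icc 1 (N / (M₀ + 1))).filter (fun d => ¬ d.Coprime h),
        (μ d : ℝ) * ∑ m ∈ Ioc M₀ (N / d), Real.log m * Λ (d * m + h)| ≤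
      ((N / (M₀ + 1) : ℕ) : ℝ) * (Real.log N * Real.log ((N + h : ℕ) : ℝ)) := by
  have hlogN : 0 ≤ Real.log N := Real.log_natCast_nonneg N
  have hlogNh : 0 ≤ Real.log ((N + h : ℕ) : ℝ) := Real.log_natCast_nonneg _
  have key : ∀ d ∈ (Icc 1 (N / (M₀ + 1))).filter (fun d => ¬ d.Coprime h),
      |(μ d : ℝ) * ∑ m ∈ Ioc M₀ (N / d), Real.log m * Λ (d * m + h)| ≤
        Real.log N * Real.log ((N + h : ℕ) : ℝ) := by
    intro d hd
    obtain ⟨hd', hcop⟩ := Finset.mem_filter.mp hd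
    have hd1 : 1 ≤ d := (Finset.mem_Icc.mp hd').1
    have hb := abs_inner_le_of_not_coprime (by omega) hh hcop M₀ (N / d)
    have hlogq : Real.log ((N / d : ℕ) : ℝ) ≤ Real.log N := by
      rcases Nat.eq_zero_or_pos (N / d) with h0 | h0
      · rw [h0]; simp [hlogN]
      · exact Real.log_le_log (by exact_mod_cast h0) (by exact_mod_cast Nat.div_le_self N d)
    have hlogK : Real.log ((d * (N / d) + h : ℕ) : ℝ) ≤ Real.log ((N + h : ℕ) : ℝ) := by
      have h1 : 1 ≤ d * (N / d) + h := le_add_left (Nat.one_le_iff_ne_zero.mpr hh)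
      exact Real.log_le_log (by exact_mod_cast h1)
        (by exact_mod_cast Nat.add_le_add_right (Nat.mul_div_le N d) h)
    have hlogq0 : 0 ≤ Real.log ((N / d : ℕ) : ℝ) := Real.log_natCast_nonneg _
    rw [abs_mul]
    have hμ : |(μ d : ℝ)| ≤ 1 := by exact_mod_cast abs_moebius_le_one
    calc _ ≤ 1 * (Real.log ((N / d : ℕ) : ℝ) * Real.log ((d * (N / d) + h : ℕ) : ℝ)) :=
          mul_le_mul hμ hb (abs_nonneg _) zero_le_one
      _ ≤ 1 * (Real.log N * Real.log ((N + h : ℕ) : ℝ)) := by gcongr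
      _ = Real.log N * Real.log ((N + h : ℕ) : ℝ) := one_mul _
  calc _ ≤ ∑ d ∈ (Icc 1 (N / (M₀ + 1))).filter (fun d => ¬ d.Coprime h),
        |(μ d : ℝ) * ∑ m ∈ Ioc M₀ (N / d), Real.log m * Λ (d * m + h)| := abs_sum_le_sum_abs _ _
    _ ≤ ∑ d ∈ (Icc 1 (N / (M₀ + 1))).filter (fun d => ¬ d.Coprime h),
          Real.log N * Real.log ((N + h : ℕ) : ℝ) := Finset.sum_le_sum key
    _ = (((Icc 1 (N / (M₀ + 1))).filter (fun d => ¬ d.Coprime h)).card : ℝ) *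
          (Real.log N * Real.log ((N + h : ℕ) : ℝ)) := by
        rw [Finset.sum_const, nsmul_eq_mul]
    _ ≤ ((N / (M₀ + 1) : ℕ) : ℝ) * (Real.log N * Real.log ((N + h : ℕ) : ℝ)) := by
        gcongr
        calc ((Icc 1 (N / (M₀ + 1))).filter (fun d => ¬ d.Coprime h)).card
            ≤ (Icc 1 (N / (M₀ + 1))).card := Finset.card_le_card (Finset.filter_subset _ _)
          _ = N / (M₀ + 1) := by simp

/-- `∑_{d ≤ D} d/φ(d) ≤ D (1 + log D)²` (crude; the true order is `≍ D`). [folklore] -/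
theorem sum_Icc_div_totient_le (D : ℕ) :
    ∑ d ∈ Icc 1 D, (d : ℝ) / Nat.totient d ≤ D * (1 + Real.log D) ^ 2 := by
  have key : ∀ d ∈ Icc 1 D, (d : ℝ) / Nat.totient d ≤ (1 + Real.log D) ^ 2 := by
    intro d hd
    obtain ⟨hd1, hdD⟩ := Finset.mem_Icc.mp hd
    have hlogd : 0 ≤ Real.log d := Real.log_natCast_nonneg d
    have h1 : 0 ≤ 1 + Real.log d := by linarith
    have hdD' : Real.log d ≤ Real.log D :=
      Real.log_le_log (by exact_mod_cast hd1) (by exact_mod_cast hdD)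
    refine (natCast_div_totient_le d).trans ?_
    gcongr
  calc ∑ d ∈ Icc 1 D, (d : ℝ) / Nat.totient d ≤ ∑ d ∈ Icc 1 D, (1 + Real.log D) ^ 2 :=
        Finset.sum_le_sum key
    _ = D * (1 + Real.log D) ^ 2 := by simp

end Summit.Parity.GeneralizedHardyLittlewood.Theorems.PairsFromMAvg
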